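import Mathlib
import HarnessLib
import Summits.Ventures.LatticeQCDFlow.Exactness.GaussianLatitude

/-!
# The engine's axis chart `(2u−1, 2πu′) ↦ (sth cos φ, sth sin φ, cth)` samples the uniform law on `S²` (Archimedes)

HONEST FRAMING: exact (Metropolis-corrected) sampling algorithms for lattice gauge theory;
figures of merit are autocorrelation/cost numbers at stated couplings and volumes; no
continuum-physics claim.

Venture `LatticeQCDFlow` (cell pub-lqcd), topic `Exactness`, FANOUT row 9 (eng-latcore, the
engine `latflow.core`).  NEW WORK of the cell over Mathlib and row 9's files
`CircleUniformAngle.lean` (uniform angle = uniform law on `S¹`), `GaussianLatitude.lean` (latitude),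
`RadialPolar.lean` / `StdGaussianRadial.lean` (Muller: the direction of `N(0, I₃)` is
`uniformSphere`) and `SU2HeatBathLaw.lean` (`E3`, the Tonelli bookkeeping `map_assemble_eq_prod`).
Nothing is cited as a fact.  Printed counterparts, NAMED ONLY: Archimedes (hat-box theorem);
Marsaglia 1972; Gattringer–Lang 2010 eq. (4.37).  RELATED IN THE TREE: row 7's
`SphereAxisDisintegration.lean` proves the general latitude disintegration
`σ_{S^{n+1}} = latitudePt_* (sinⁿθ dθ ⊗ σ_{Sⁿ})` of Mathlib's `toSphere` by cone integration; the
present file takes an independent Gaussian route (Muller + two planar polar changes of variables)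
straight to the ENGINE's chart `(2u−1, 2πu′)` and the normalised `uniformSphere`.

The SU(2) heat bath of `latflow.core` (`csrc/latcore_template.c` `update_link`) draws the AXIS
of the new quaternion as `cth = 2u − 1`, `phi = 2π u′`, `sth = √(1 − cth²)`,
`n̂ = (sth cos φ, sth sin φ, cth)` from two uniforms.  `SU2HeatBathSampler.lean` proved that a
`uniformSphere`-distributed axis (with A3's `a₀`) gives exactly the link law and listed THIS
chart as NOT TYPED.  Here:

* (`GaussianLatitude.lean`: `N(0,I₃) = N(0,1) ⊗ N(0,I₂)` along `x ↦ (x₂,(x₀,x₁))`; the latitude of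
  `N(0,1) ⊗ Rayleigh` is uniform on `(−1,1)` = `latLaw`, the law of the engine's `2u − 1`);
* `axisVec c w = (√(1−c²) w₀, √(1−c²) w₁, c)`, `axisPt`; **`dirSphere_eq_axisPt`** — every
  `x ≠ 0` has direction `axisPt (latitude (x₂, ‖(x₀,x₁)‖)) (dir (x₀,x₁))`;
* **`map_axisChart_unitLaw`** — ARCHIMEDES FOR THE ENGINE: `(u, u′) ↦ axisPt (2u−1) (cos 2πu′, sin 2πu′)`
  pushes `unitLaw ⊗ unitLaw` forward to `uniformSphere (volume : Measure E3)`; `axisChart_coe` —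
  for `u ∈ [0,1]` the chart IS the engine's vector `(sth cos φ, sth sin φ, cth)`.

With `KennedyPendletonSampler.map_assembleSU2_loopLaw_kpRound` / `CreutzSampler` this types EVERY
random draw of the engine's SU(2) link heat bath, in idealised real arithmetic.
NOT CLAIMED: floating point; the `fmax(0, ·)` guards (no-ops in exact arithmetic on `[−1,1]`).
-/

namespace Summit.Ventures.LatticeQCDFlow.Exactness

open MeasureTheory Measure Metric Set Real ProbabilityTheory WithLp
open scoped ENNReal

/-! ## §3 The axis with prescribed latitude and longitude -/

/-- The vector `(√(1−c²) w₀, √(1−c²) w₁, c) ∈ E3`. -/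
noncomputable def axisVec (c : ℝ) (w : sphere (0 : E2) 1) : E3 :=
  toLp 2 (Fin.snoc (fun j : Fin 2 => Real.sqrt (1 - c ^ 2) * (w : E2) j) c)

/-- The first two coordinates of the axis vector. -/
@[simp] theorem axisVec_apply_castSucc (c : ℝ) (w : sphere (0 : E2) 1) (j : Fin 2) :
    axisVec c w (Fin.castSucc j) = Real.sqrt (1 - c ^ 2) * (w : E2) j := by
  rw [axisVec, PiLp.toLp_apply, Fin.snoc_castSucc]

/-- The last coordinate of the axis vector. -/
@[simp] theorem axisVec_apply_last (c : ℝ) (w : sphere (0 : E2) 1) :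
    axisVec c w (Fin.last 2) = c := by
  rw [axisVec, PiLp.toLp_apply, Fin.snoc_last]

/-- A point of the unit circle has `w₀² + w₁² = 1`. -/
theorem norm_sq_coe_sphere_two (w : sphere (0 : E2) 1) : ∑ j : Fin 2, ((w : E2) j) ^ 2 = 1 := by
  rw [← EuclideanSpace.real_norm_sq_eq, norm_eq_of_mem_sphere w, one_pow]

/-- For `c² ≤ 1` the axis vector is a unit vector. -/
theorem norm_axisVec {c : ℝ} (hc : c ^ 2 ≤ 1) (w : sphere (0 : E2) 1) : ‖axisVec c w‖ = 1 := by
  have h : ‖axisVec c w‖ ^ 2 = 1 := by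
    rw [EuclideanSpace.real_norm_sq_eq, Fin.sum_univ_castSucc]
    simp only [axisVec_apply_castSucc, axisVec_apply_last, mul_pow]
    rw [← Finset.mul_sum, norm_sq_coe_sphere_two, mul_one, Real.sq_sqrt (by linarith)]
    ring
  have h0 : 0 ≤ ‖axisVec c w‖ := norm_nonneg _
  nlinarith [h, h0]

/-- `axisVec` is jointly measurable. -/
theorem measurable_axisVec : Measurable fun p : ℝ × sphere (0 : E2) 1 => axisVec p.1 p.2 := by
  refine (measurable_toLp 2 _).comp (measurable_pi_iff.mpr fun i => ?_)
  refine Fin.lastCases ?_ (fun j => ?_) i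
  · simp only [Fin.snoc_last]; exact measurable_fst
  · simp only [Fin.snoc_castSucc]
    exact (measurable_fst.pow_const 2 |>.const_sub 1 |>.sqrt).mul
      (((measurable_pi_apply j).comp (measurable_ofLp 2 _)).comp (measurable_subtype_coe.comp measurable_snd))

/-- **The axis point** with latitude `c` and longitude `w` (a point of `S²`; `dirSphere` only
normalises when `c² > 1`, which the engine never produces). -/
noncomputable def axisPt (p : ℝ × sphere (0 : E2) 1) : sphere (0 : E3) 1 := dirSphere (axisVec p.1 p.2)

/-- `axisPt` is measurable. -/
theorem measurable_axisPt : Measurable axisPt := measurable_dirSphere.comp measurable_axisVec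

/-- For `c² ≤ 1`, `axisPt (c, w)` IS the vector `axisVec c w`. -/
theorem axisPt_coe {c : ℝ} (hc : c ^ 2 ≤ 1) (w : sphere (0 : E2) 1) : (axisPt (c, w) : E3) = axisVec c w := by
  have h := dirSphere_coe_sphere (⟨axisVec c w, by rw [mem_sphere_zero_iff_norm, norm_axisVec hc]⟩ : sphere (0 : E3) 1)
  exact congrArg Subtype.val h

/-- **Every non-zero vector points along the axis with its own latitude and longitude**:
`dirSphere x = axisPt (latitude (x₂, ‖(x₀,x₁)‖), dirSphere (x₀,x₁))`. -/
theorem dirSphere_eq_axisPt {x : E3} (hx : x ≠ 0) :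
    dirSphere x = axisPt (latitude (x (Fin.last 2), ‖initE3 x‖), dirSphere (initE3 x)) := by
  have hρ : 0 < ‖x‖ := norm_pos_iff.mpr hx
  have hρeq : Real.sqrt (‖initE3 x‖ ^ 2 + x (Fin.last 2) ^ 2) = ‖x‖ := by
    rw [← norm_sq_E3, Real.sqrt_sq hρ.le]
  -- the axis vector is `‖x‖⁻¹ • x`
  have hvec : axisVec (latitude (x (Fin.last 2), ‖initE3 x‖)) (dirSphere (initE3 x)) = ‖x‖⁻¹ • x := by
    have hc : latitude (x (Fin.last 2), ‖initE3 x‖) = x (Fin.last 2) / ‖x‖ := by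
      rw [latitude, hρeq]
    have hsq : Real.sqrt (1 - (x (Fin.last 2) / ‖x‖) ^ 2) = ‖initE3 x‖ / ‖x‖ := by
      rw [show 1 - (x (Fin.last 2) / ‖x‖) ^ 2 = (‖initE3 x‖ / ‖x‖) ^ 2 by
        rw [div_pow, div_pow, eq_div_iff (pow_ne_zero 2 hρ.ne'), sub_mul, div_mul_cancel₀ _ (pow_ne_zero 2 hρ.ne'),
          one_mul, norm_sq_E3]; ring]
      exact Real.sqrt_sq (div_nonneg (norm_nonneg _) hρ.le)
    ext i
    rw [hc]
    refine Fin.lastCases ?_ (fun j => ?_) i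
    · rw [axisVec_apply_last, PiLp.smul_apply, smul_eq_mul, div_eq_inv_mul]
    · rw [axisVec_apply_castSucc, hsq, PiLp.smul_apply, smul_eq_mul]
      by_cases h0 : initE3 x = 0
      · have : x (Fin.castSucc j) = 0 := by
          have := congrArg (fun y : E2 => y j) h0
          simpa using this
        rw [h0, norm_zero, zero_div, zero_mul, this, mul_zero]
      · rw [dirSphere_coe h0, PiLp.smul_apply, smul_eq_mul, initE3_apply]
        field_simp
  rw [axisPt, hvec, dirSphere_smul (inv_pos.mpr hρ)]

/-! ## §4 Archimedes: the engine's chart samples `uniformSphere` -/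

/-- **The engine's axis chart**: `(u, u′) ↦ axisPt (2u − 1, (cos 2πu′, sin 2πu′))`. -/
noncomputable def axisChart (p : ℝ × ℝ) : sphere (0 : E3) 1 := axisPt (2 * p.1 - 1, circlePt (2 * π * p.2))

/-- `axisChart` is measurable. -/
theorem measurable_axisChart : Measurable axisChart :=
  measurable_axisPt.comp ((by fun_prop : Measurable fun p : ℝ × ℝ => 2 * p.1 - 1).prodMk
    (measurable_circlePt.comp (by fun_prop : Measurable fun p : ℝ × ℝ => 2 * π * p.2)))

/-- For `u ∈ [0, 1]` the chart is the engine's vector `(sth cos φ, sth sin φ, cth)` with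
`cth = 2u − 1`, `sth = √(1 − cth²)`, `φ = 2πu′`. -/
theorem axisChart_coe {u u' : ℝ} (hu : u ∈ Icc (0 : ℝ) 1) :
    (axisChart (u, u') : E3) = toLp 2 ![Real.sqrt (1 - (2 * u - 1) ^ 2) * Real.cos (2 * π * u'),
      Real.sqrt (1 - (2 * u - 1) ^ 2) * Real.sin (2 * π * u'), 2 * u - 1] := by
  have hc : (2 * u - 1) ^ 2 ≤ 1 := by nlinarith [hu.1, hu.2]
  rw [axisChart, axisPt_coe hc]
  ext i
  fin_cases i
  · exact (axisVec_apply_castSucc _ _ 0).trans (by simp)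
  · exact (axisVec_apply_castSucc _ _ 1).trans (by simp)
  · exact (axisVec_apply_last _ _).trans (by simp)

/-- The direction of `N(0, I₃)` factors through (latitude, longitude): its law of
`(latitude, dirSphere ∘ initE3)` is `latLaw ⊗ uniformSphere(S¹)`. -/
theorem stdGaussian_map_latitude_longitude :
    (stdGaussian E3).map (fun x => (latitude (x (Fin.last 2), ‖initE3 x‖), dirSphere (initE3 x))) =
      latLaw.prod (uniformSphere (volume : Measure E2)) := by
  have hdn : Measurable fun y : E2 => (dirSphere y, ‖y‖) := measurable_dirSphere_norm
  have hA : Measurable fun p : ℝ × (sphere (0 : E2) 1 × ℝ) => (latitude (p.1, p.2.2), p.2.1) :=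
    (measurable_latitude.comp (measurable_fst.prodMk (measurable_snd.comp measurable_snd))).prodMk
      (measurable_fst.comp measurable_snd)
  have hcomp : (fun x : E3 => (latitude (x (Fin.last 2), ‖initE3 x‖), dirSphere (initE3 x))) =
      (fun p : ℝ × (sphere (0 : E2) 1 × ℝ) => (latitude (p.1, p.2.2), p.2.1)) ∘
        (Prod.map id fun y : E2 => (dirSphere y, ‖y‖)) ∘ splitE3 := by
    funext x; rfl
  rw [hcomp, ← Measure.map_map hA ((measurable_id.prodMap hdn).comp measurable_splitE3),
    ← Measure.map_map (measurable_id.prodMap hdn) measurable_splitE3, stdGaussian_map_splitE3,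
    ← Measure.map_prod_map _ _ measurable_id hdn, Measure.map_id,
    stdGaussian_map_dirSphere_norm (Fin 2), map_assemble_eq_prod _ _ _ measurable_latitude]
  rw [show ((stdGaussian E2).map fun y => ‖y‖) = rayleighLaw from rfl, map_latitude]

/-- **ARCHIMEDES FOR THE ENGINE.**  Drawing `cth = 2u − 1` and `φ = 2πu′` from two independent
uniforms and forming `(√(1−cth²) cos φ, √(1−cth²) sin φ, cth)` samples EXACTLY the uniform
probability measure on the unit sphere `S² ⊂ E3`. -/
theorem map_axisChart_unitLaw :
    (unitLaw.prod unitLaw).map axisChart = uniformSphere (volume : Measure E3) := by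
  -- the engine side: `latLaw ⊗ uniformSphere(S¹)` pushed through `axisPt`
  have hengine : (unitLaw.prod unitLaw).map axisChart =
      (latLaw.prod (uniformSphere (volume : Measure E2))).map axisPt := by
    have hm1 : Measurable fun u : ℝ => 2 * u - 1 := by fun_prop
    have hm2 : Measurable fun u : ℝ => circlePt (2 * π * u) := measurable_circlePt.comp (by fun_prop)
    rw [show axisChart = axisPt ∘ Prod.map (fun u : ℝ => 2 * u - 1) (fun u : ℝ => circlePt (2 * π * u)) from rfl,
      ← Measure.map_map measurable_axisPt (hm1.prodMap hm2), ← Measure.map_prod_map _ _ hm1 hm2, map_circlePt_unitLaw]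
    rfl
  -- the sphere side: Muller's Gaussian direction, factored through (latitude, longitude)
  have hT : Measurable fun x : E3 => (latitude (x (Fin.last 2), ‖initE3 x‖), dirSphere (initE3 x)) :=
    (measurable_latitude.comp (((measurable_pi_apply (Fin.last 2)).comp (measurable_ofLp 2 _)).prodMk
      measurable_initE3.norm)).prodMk (measurable_dirSphere.comp measurable_initE3)
  have hae : (dirSphere : E3 → sphere (0 : E3) 1) =ᵐ[stdGaussian E3]
      axisPt ∘ fun x => (latitude (x (Fin.last 2), ‖initE3 x‖), dirSphere (initE3 x)) := by
    have h0 : (stdGaussian E3) {0} = 0 := by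
      rw [stdGaussian_eq_withDensity_radial]
      exact withDensity_absolutelyContinuous _ _ (measure_singleton _)
    filter_upwards [measure_eq_zero_iff_ae_notMem.mp h0] with x hx
    exact dirSphere_eq_axisPt hx
  rw [hengine, ← stdGaussian_map_dirSphere (Fin 3), Measure.map_congr hae,
    ← Measure.map_map measurable_axisPt hT, stdGaussian_map_latitude_longitude]

end Summit.Ventures.LatticeQCDFlow.Exactness
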